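import Literature.Analysis.FluidPDE.NSSereginLimitingProcedureHolds
import Literature.Analysis.FluidPDE.NSSereginLimitDecayHolds
import Literature.Analysis.FluidPDE.NSSereginMildStabilityHolds
import Literature.Analysis.FluidPDE.NSLocalLerayFarFieldVorticityBypass
import Literature.Analysis.FluidPDE.NSBoundedHigherRegularityQuantProofs
import Literature.Analysis.FluidPDE.NSSereginMildRescaling
import Literature.Analysis.FluidPDE.NSLerayHopfSereginProofs
import Literature.Analysis.FluidPDE.KatoFarFieldBound
import Literature.Analysis.FluidPDE.MildL3SmoothHolds
import Literature.Analysis.FluidPDE.NSSereginEnergyApproximants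
import Literature.Analysis.FluidPDE.LocalLerayWeakStrongUniquenessHolds
import HarnessLib

/-!
# Seregin's `L³` blow-up criterion for energy solutions (Seregin 2012, Thm. 1.1) along the
# printed proof: §3 (limiting procedure) and §4 (backward uniqueness and the contradiction)

Analysis/FluidPDE proof file (theorems only: no definition, no named fact, no `sorry`) on the
line of the named fact `Literature.Analysis.FluidPDE.seregin_L3_blowup` (`NSLerayHopf.lean`,
**ns.S08**; G. Seregin, Comm. Math. Phys. 312 (2012) 833–845 = arXiv:1104.3615, **Thm. 1.1**;
= G. Seregin, *Lecture Notes on Regularity Theory for the Navier–Stokes Equations* (2014),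
Ch. 7, Thm. 1.1, pp. 130–138), continuing `NSSereginEnergyApproximants.lean` (§2: the rescaled
energy solution as local energy solutions up to the blow-up time, with uniform local energy
control from the `L³` bound on the data).

The tree proves **ns.S08** through Lemarié-Rieusset's *mild* form of Seregin's theorem
(`seregin_L3_blowup_of_U_X_L8_S`, `NSLerayHopfSereginMildLiveLeaves.lean`), whose approximants
are *constructed* local Leray solutions and which therefore rests on the extension step of the
`E²` existence theory (`localEnergySolution_extension_of_memE2`, Lemarié-Rieusset 2016, Thm. 14.8,
Step 2). Seregin's printed proof for *energy* solutions needs no existence theorem: its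
approximants are restrictions of the given solution (§2, (2.3)). This file formalises §§3–4 of
that proof for the tree's **ns.S08** hypotheses:

* `localEnergy_compactness_sameInterval` — **§3, the limiting procedure on the closed interval
  `[0, T₀]`** (Seregin 2012, (3.2)–(3.9) with the datum `a₀` "the weak `L₃`-limit of the sequence
  `u^{(k)}(·,−S)`" and "`u → a₀` in `L_{2,loc}` as `s ↓ −S`"; Seregin 2014, (7.3.2)–(7.3.12)): the
  tree's `lemarieRieusset_localLeray_compactness_of_parts` (`NSSereginMildCompactness.lean`, now
  with both parts discharged: `seregin2014_localEnergy_limitingProcedure_holds`,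
  `seregin2014_limit_decay_holds`), whose proof produces the limit on the *same* interval
  `[0, T₀]` before restricting it to `[0, T₁]`, `T₁ < T₀`, as Lemarié-Rieusset's statement
  demands — here the restriction is dropped, because on Seregin's line the final time of the
  strip *is* the blow-up time.
* `isRegular_finalTime_of_frequently_eLpNorm_three_le` — **§4, the core**: for a Leray–Hopf
  solution on `[0, T)`, regular on the open strip, with `‖u(t_k)‖₃ ≤ M` along `t_k ↑ T`, every
  point `(T, x₀)` is regular. Proof (Seregin 2012, pp. 3–6): rescale about `(T, x₀)` along `t_k`
  (`IsLerayHopfOn.exists_isLocalEnergySolutionOn_rescaled_restart`), control the local energy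
  uniformly (`exists_localEnergy_bounds_of_L3_data`) and the initial layer uniformly (**the
  hypothesis `hlayer`**, Jia–Šverák's Lemma 8 = Seregin's (2.13) on a slab, to be discharged by
  its own seat), pass to the limit (`localEnergy_compactness_sameInterval`), observe that the
  limit vanishes at the final time because "`‖v(·,T)‖₃ < ∞`" ((2.2), (4.2):
  `tendsto_integral_inner_blowup_of_memLp_three`), conclude `u ≡ 0` on the strip by backward
  uniqueness for local Leray solutions (Lemarié-Rieusset 2016, Thm. 15.4 =
  `lemarieRieusset_backward_uniqueness_slab`, from **U** `local_leray_weak_strong_uniqueness`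
  and the discharged **S** `NSBoundedHigherRegularityBounds_holds`), and transport boundedness
  back to the approximants by the stability of singular points at the final time
  (`lemarieRieusset_singular_point_stability_holds`) and the inverse scaling.
* `seregin_L3_blowup_of_U_of_layer` — **Thm. 1.1 in the tree's form ns.S08** from **U** and the
  slab initial layer: the maximal smooth Leray–Hopf solution is a Kato solution on `[0, T)` whose
  lifespan is maximal (as in `seregin_L3_blowup_of_mild`), so `(T, x₀)` is singular for some `x₀`
  (`lemarieRieusset_singular_point_of_blowup_holds`, Lemarié-Rieusset 2016, Thm. 15.1 (C)) —
  contradicting the core when `‖u(t)‖₃ ↛ ∞`.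

## References

* G. Seregin, Comm. Math. Phys. 312 (2012) 833–845 = arXiv:1104.3615, Thm. 1.1, §§2–4.
  [Seregin2012CMP]
* G. Seregin, *Lecture Notes on Regularity Theory for the Navier–Stokes Equations*, World
  Scientific (2014), Ch. 7, Thm. 1.1 and §§7.2–7.3; App. B §B.4. [Seregin2014]
* P. G. Lemarié-Rieusset, *The Navier–Stokes Problem in the 21st Century* (2016), Thm. 14.7,
  Thm. 15.1 (C), Thm. 15.4, proof of Thm. 15.5 (PDF pp. 570–573). [LemarieRieusset2016]
* H. Jia, V. Šverák, SIAM J. Math. Anal. 45 (2013) = arXiv:1201.1592, Lemma 8. [JiaSverak2013]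
-/

noncomputable section

open MeasureTheory TopologicalSpace Set Function Filter Metric
open _root_.Topology
open scoped ENNReal NNReal RealInnerProductSpace

namespace Literature.Analysis.FluidPDE

local notation "ℝ³" => EuclideanSpace ℝ (Fin 3)

/-! ### §3: the limiting procedure on the closed interval `[0, T₀]` -/

/-- **The limiting procedure for local energy solutions with data bounded in `L³`, on the same
closed interval** (Seregin 2012, §3, (3.2)–(3.9); Seregin 2014, Ch. 7, (7.3.2)–(7.3.12);
Lemarié-Rieusset 2016, proof of Thm. 15.5, pp. 570–571). Hypotheses as in
`lemarieRieusset_localLeray_compactness` (local energy solutions `(v_n, π_n)` on `ℝ³ × (0, T₀)`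
with viscosity `ν`, data `a_n ∈ L³`, `‖a_n‖₃ ≤ M`, weakly divergence free, uniform every-time
unit-ball energies and unit-cylinder dissipations `≤ C`, and the uniform initial layer
`‖v_n(t) − W_{νt} * a_n‖_{L²(B(x₀,1))} ≤ η(t)`, `η → 0`); conclusion: a subsequence and a local
energy solution `(v_∞, π_∞)` **on `ℝ³ × (0, T₀)`** in Seregin's class, with weakly divergence-free
datum `a_∞ ∈ L³`, `‖a_∞‖₃ ≤ M`, the same bounds, `v_{n_k}(t) → v_∞(t)` in the sense of
distributions for every `t ∈ [0, T₀]` and `v_{n_k} → v_∞` in `L²((0,T₀) × B(0,R))`. The proof is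
that of `lemarieRieusset_localLeray_compactness_of_parts` (`NSSereginMildCompactness.lean`) with
`seregin2014_localEnergy_limitingProcedure_holds` and `seregin2014_limit_decay_holds`, minus the
final restriction to a shorter interval.
[cite: Seregin2012CMP, §3 (3.2)–(3.9)] [cite: Seregin2014, Ch. 7 §7.3 (7.3.2)–(7.3.12)] [cite: LemarieRieusset2016, proof of Thm. 15.5, pp. 570–571] -/
theorem localEnergy_compactness_sameInterval {ν T₀ : ℝ} (hν : 0 < ν) (hT₀ : 0 < T₀) (M : ℝ)
    (C : ℝ≥0) (η : ℝ → ℝ≥0) (hη : Tendsto η (𝓝[>] 0) (𝓝 0))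
    (a : ℕ → EuclideanSpace ℝ (Fin 3) → EuclideanSpace ℝ (Fin 3))
    (v : ℕ → ℝ → EuclideanSpace ℝ (Fin 3) → EuclideanSpace ℝ (Fin 3))
    (π : ℕ → ℝ → EuclideanSpace ℝ (Fin 3) → ℝ)
    (ha : ∀ n, MemLp (a n) 3 volume ∧ eLpNorm (a n) 3 volume ≤ ENNReal.ofReal M ∧
      IsWeaklyDivFree (a n))
    (hv : ∀ n, IsLocalEnergySolutionOn T₀ ν (a n) (v n) (π n))
    (hC : ∀ n, ∀ t ∈ Icc 0 T₀, ∀ x₀ : EuclideanSpace ℝ (Fin 3),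
      ∫⁻ x in ball x₀ 1, ‖v n t x‖ₑ ^ 2 ≤ C)
    (hG : ∀ n, ∃ G : ℝ → EuclideanSpace ℝ (Fin 3) →
        EuclideanSpace ℝ (Fin 3) →L[ℝ] EuclideanSpace ℝ (Fin 3),
      HasWeakSpatialGradientOn (slab (EuclideanSpace ℝ (Fin 3)) (Ioo 0 T₀) isOpen_Ioo) (v n) G ∧
        ∀ x₀ : EuclideanSpace ℝ (Fin 3), ∫⁻ z in Ioo 0 T₀ ×ˢ ball x₀ 1,
          ENNReal.ofReal (frobeniusNormSq (G z.1 z.2)) ≤ C)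
    (hlayer : ∀ n, ∀ t ∈ Ioo 0 T₀, ∀ x₀ : EuclideanSpace ℝ (Fin 3),
      eLpNorm (v n t - heatTest ν (a n) t) 2 (volume.restrict (ball x₀ 1)) ≤ η t) :
    ∃ (φ : ℕ → ℕ) (aL : EuclideanSpace ℝ (Fin 3) → EuclideanSpace ℝ (Fin 3))
      (vL : ℝ → EuclideanSpace ℝ (Fin 3) → EuclideanSpace ℝ (Fin 3))
      (πL : ℝ → EuclideanSpace ℝ (Fin 3) → ℝ),
      StrictMono φ ∧ MemLp aL 3 volume ∧ eLpNorm aL 3 volume ≤ ENNReal.ofReal M ∧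
      IsWeaklyDivFree aL ∧ IsLocalEnergySolutionOn T₀ ν aL vL πL ∧
      (∀ t ∈ Icc 0 T₀, ∀ x₀ : EuclideanSpace ℝ (Fin 3),
        ∫⁻ x in ball x₀ 1, ‖vL t x‖ₑ ^ 2 ≤ C) ∧
      (∃ G : ℝ → EuclideanSpace ℝ (Fin 3) →
          EuclideanSpace ℝ (Fin 3) →L[ℝ] EuclideanSpace ℝ (Fin 3),
        HasWeakSpatialGradientOn (slab (EuclideanSpace ℝ (Fin 3)) (Ioo 0 T₀) isOpen_Ioo) vL G ∧
          ∀ x₀ : EuclideanSpace ℝ (Fin 3), ∫⁻ z in Ioo 0 T₀ ×ˢ ball x₀ 1,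
            ENNReal.ofReal (frobeniusNormSq (G z.1 z.2)) ≤ C) ∧
      (∀ t ∈ Icc 0 T₀, ∀ ψ : EuclideanSpace ℝ (Fin 3) → EuclideanSpace ℝ (Fin 3),
        FunctionSpaces.IsTestFunctionOn (⊤ : Opens (EuclideanSpace ℝ (Fin 3))) ψ →
          Tendsto (fun k => ∫ x, ⟪v (φ k) t x, ψ x⟫) atTop (𝓝 (∫ x, ⟪vL t x, ψ x⟫))) ∧
      ∀ R : ℝ, 0 < R →
        Tendsto (fun k => ∫⁻ z in Ioo 0 T₀ ×ˢ ball (0 : EuclideanSpace ℝ (Fin 3)) R,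
          ‖v (φ k) z.1 z.2 - vL z.1 z.2‖ₑ ^ 2) atTop (𝓝 0) := by
  -- ### Step 1: the limiting procedure on `[0, T₀]`
  obtain ⟨φ, u, p, c, hφ, hc, hsuit, hp, hmeas, huC, huG, hL2, hL3, hunif, hpress⟩ :=
    seregin2014_localEnergy_limitingProcedure_holds hν hT₀ C a v π hv hC hG
  have hpt : ∀ t ∈ Icc 0 T₀, ∀ ψ : EuclideanSpace ℝ (Fin 3) → EuclideanSpace ℝ (Fin 3),
      FunctionSpaces.IsTestFunctionOn (⊤ : Opens (EuclideanSpace ℝ (Fin 3))) ψ →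
        Tendsto (fun k => ∫ x, ⟪v (φ k) t x, ψ x⟫) atTop (𝓝 (∫ x, ⟪u t x, ψ x⟫)) :=
    fun t ht ψ hψ => (hunif ψ hψ).tendsto_at ht
  -- ### Step 2: the datum of the limit, `aL = v_∞(0)`
  set aL : EuclideanSpace ℝ (Fin 3) → EuclideanSpace ℝ (Fin 3) := u 0 with haL_def
  have h0 : (0 : ℝ) ∈ Icc 0 T₀ := ⟨le_rfl, hT₀.le⟩
  have hconv0 : ∀ ψ : EuclideanSpace ℝ (Fin 3) → EuclideanSpace ℝ (Fin 3),
      FunctionSpaces.IsTestFunctionOn (⊤ : Opens (EuclideanSpace ℝ (Fin 3))) ψ →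
        Tendsto (fun k => ∫ x, ⟪a (φ k) x, ψ x⟫) atTop (𝓝 (∫ x, ⟪aL x, ψ x⟫)) := by
    intro ψ hψ
    have e : ∀ k, ∫ x, ⟪a (φ k) x, ψ x⟫ = ∫ x, ⟪v (φ k) 0 x, ψ x⟫ := fun k =>
      ((hv (φ k)).integral_inner_zero_eq hT₀ ((ha (φ k)).1.locallyIntegrable (by norm_num)) hψ).symm
    simp_rw [e]
    exact hpt 0 h0 ψ hψ
  -- "As `‖v_{n_k}(0,.)‖₃ ≤ M`, we find as well that `v_∞(0,.) ∈ L³`"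
  set M' : ℝ := max M 0 with hM'
  have haM' : ∀ n, eLpNorm (a n) 3 volume ≤ ENNReal.ofReal M' := fun n =>
    (ha n).2.1.trans (ENNReal.ofReal_le_ofReal (le_max_left _ _))
  have haL : MemLp aL 3 volume ∧ eLpNorm aL 3 volume ≤ ENNReal.ofReal M' := by
    refine FunctionSpaces.memLp_three_of_forall_abs_integral_inner_le (hmeas 0 h0) ?_
      (le_max_right _ _) ?_
    · intro x
      refine ⟨ball x 1, ball_mem_nhds x one_pos, ?_⟩
      have h2 := memLp_two_restrict_ball_of_lintegral_le (hmeas 0 h0) x (huC 0 h0 x)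
      exact (memLp_two_iff_integrable_sq_norm h2.1).1 h2
    · intro ψ hψ
      have hψq : MemLp ψ (3 / 2 : ℝ≥0∞) volume :=
        hψ.contDiff.continuous.memLp_of_hasCompactSupport hψ.hasCompactSupport
      have hbd : ∀ k, |∫ x, ⟪a (φ k) x, ψ x⟫| ≤ M' * (eLpNorm ψ (3 / 2 : ℝ≥0∞) volume).toReal :=
        fun k => (abs_integral_inner_le_eLpNorm_three_mul (ha (φ k)).1 hψq).trans
          (mul_le_mul_of_nonneg_right
            (ENNReal.toReal_le_of_le_ofReal (le_max_right _ _) (haM' (φ k))) ENNReal.toReal_nonneg)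
      exact le_of_tendsto ((continuous_abs.tendsto _).comp (hconv0 ψ hψ)) (Eventually.of_forall hbd)
  have hofM : ENNReal.ofReal M' = ENNReal.ofReal M := by
    rcases le_or_gt 0 M with hM | hM
    · rw [hM', max_eq_left hM]
    · rw [hM', max_eq_right hM.le, ENNReal.ofReal_zero, ENNReal.ofReal_of_nonpos hM.le]
  have haLdiv : IsWeaklyDivFree aL :=
    IsWeaklyDivFree.of_tendsto_integral_inner (fun k => (ha (φ k)).2.2) hconv0
  -- ### Step 3: "`‖v_∞(t) − W_{νt} * v_∞(0)‖_{L²_uloc} ≤ η(t)`", and the initial condition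
  have hlayerL : ∀ t ∈ Ioo 0 T₀, ∀ x₀ : EuclideanSpace ℝ (Fin 3),
      eLpNorm (u t - heatTest ν aL t) 2 (volume.restrict (ball x₀ 1)) ≤ η t := by
    intro t ht x₀
    have htI : t ∈ Icc 0 T₀ := ⟨ht.1.le, ht.2.le⟩
    exact eLpNorm_sub_heatTest_le_of_tendsto hν ht.1 (fun k => (ha (φ k)).1) (fun k => haM' (φ k))
      haL.1 haL.2 hconv0 (hpt t htI) x₀ (fun k => (hv (φ k)).memLp_two_ball htI x₀)
      (memLp_two_restrict_ball_of_lintegral_le (hmeas t htI) x₀ (huC t htI x₀))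
      (fun k => hlayer (φ k) t ht x₀)
  have hinit : ∀ K : Set (EuclideanSpace ℝ (Fin 3)), IsCompact K →
      Tendsto (fun t => ∫⁻ x in K, ‖u t x - aL x‖ₑ ^ 2) (𝓝[>] 0) (𝓝 0) := fun K hK =>
    tendsto_lintegral_sub_datum_of_layer hν hT₀ hη haL.1 (fun t ht => hmeas t ⟨ht.1.le, ht.2.le⟩)
      hlayerL hK
  -- ### Step 4: weak continuity of the limit (uniform limit of continuous pairings)
  have hwc : ∀ ψ : EuclideanSpace ℝ (Fin 3) → EuclideanSpace ℝ (Fin 3),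
      FunctionSpaces.IsTestFunctionOn (⊤ : Opens (EuclideanSpace ℝ (Fin 3))) ψ →
        ContinuousOn (fun t => ∫ x, ⟪u t x, ψ x⟫) (Icc 0 T₀) := fun ψ hψ =>
    (hunif ψ hψ).continuousOn (Frequently.of_forall fun k => (hv (φ k)).weakContinuous ψ hψ)
  -- ### Step 5: the local pressure expansion (7.3.10) of the limit (Seregin 2014, §B.4, p. 163),
  -- and the decay at spatial infinity of the limit (F2: Thm. 1.6 with Lemma B.6)
  set w : ℕ → ℝ → EuclideanSpace ℝ (Fin 3) → EuclideanSpace ℝ (Fin 3) := fun k => v (φ k) with hw_def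
  set q : ℕ → ℝ → EuclideanSpace ℝ (Fin 3) → ℝ := fun k t x => π (φ k) t x - c k t with hq_def
  have hw : ∀ k, IsLocalLeraySolutionOn T₀ ν (a (φ k)) (w k) (q k) := fun k =>
    (hv (φ k)).isLocalLeraySolutionOn_sub_gauge (hc k).1 (hc k).2
  have hwC : ∀ k, ∀ᵐ t ∂(volume.restrict (Ioo (0 : ℝ) T₀)),
      ∀ x₀ : EuclideanSpace ℝ (Fin 3), ∫⁻ y in ball x₀ 1, ‖w k t y‖ₑ ^ 2 ≤ C := fun k =>
    (ae_restrict_mem measurableSet_Ioo).mono fun t ht x₀ => hC (φ k) t ⟨ht.1.le, ht.2.le⟩ x₀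
  have huA : ∀ᵐ t ∂(volume.restrict (Ioo (0 : ℝ) T₀)),
      ∀ x₀ : EuclideanSpace ℝ (Fin 3), ∫⁻ y in ball x₀ 1, ‖u t y‖ₑ ^ 2 ≤ C :=
    (ae_restrict_mem measurableSet_Ioo).mono fun t ht x₀ => huC t ⟨ht.1.le, ht.2.le⟩ x₀
  have hpl : LocallyIntegrableOn (uncurry p)
      (Ioo (0 : ℝ) T₀ ×ˢ (univ : Set (EuclideanSpace ℝ (Fin 3)))) volume :=
    hsuit.distributional.2.2.1
  have hum : AEStronglyMeasurable (uncurry u)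
      (volume.restrict (Ioo (0 : ℝ) T₀ ×ˢ (univ : Set (EuclideanSpace ℝ (Fin 3))))) :=
    hsuit.distributional.1.aestronglyMeasurable
  have hpm : AEStronglyMeasurable (uncurry p)
      (volume.restrict (Ioo (0 : ℝ) T₀ ×ˢ (univ : Set (EuclideanSpace ℝ (Fin 3))))) :=
    hpl.aestronglyMeasurable
  -- `u ∈ L³((0,T₀) × B_R)` from (7.3.2)
  have hu3 : ∀ R : ℝ, 0 < R → ∫⁻ z in Ioo 0 T₀ ×ˢ ball (0 : EuclideanSpace ℝ (Fin 3)) R,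
      ‖u z.1 z.2‖ₑ ^ (3 : ℕ) < ∞ := by
    intro R hR
    obtain ⟨k, hk⟩ := ((hL3 R hR).eventually (gt_mem_nhds (zero_lt_one' ℝ≥0∞))).exists
    have h3k : ∫⁻ z in Ioo 0 T₀ ×ˢ ball (0 : EuclideanSpace ℝ (Fin 3)) R,
        ‖w k z.1 z.2‖ₑ ^ (3 : ℕ) < ∞ := (hw k).lintegral_cube_box_lt_top 0 R
    set μB : Measure (ℝ × EuclideanSpace ℝ (Fin 3)) :=
      volume.restrict (Ioo 0 T₀ ×ˢ ball (0 : EuclideanSpace ℝ (Fin 3)) R) with hμB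
    have hμB : μB ≤ volume.restrict (Ioo (0 : ℝ) T₀ ×ˢ (univ : Set (EuclideanSpace ℝ (Fin 3)))) :=
      Measure.restrict_mono (prod_mono Subset.rfl (subset_univ _)) le_rfl
    have hwe : AEMeasurable (fun z : ℝ × EuclideanSpace ℝ (Fin 3) => ‖w k z.1 z.2‖ₑ ^ (3 : ℕ)) μB :=
      (((hw k).aestronglyMeasurable.mono_measure hμB).enorm.pow_const _)
    have hde : AEMeasurable (fun z : ℝ × EuclideanSpace ℝ (Fin 3) =>
        ‖w k z.1 z.2 - u z.1 z.2‖ₑ ^ (3 : ℕ)) μB :=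
      ((((hw k).aestronglyMeasurable.sub hum).mono_measure hμB).enorm.pow_const _)
    have hpt : ∀ z : ℝ × EuclideanSpace ℝ (Fin 3), ‖u z.1 z.2‖ₑ ^ (3 : ℕ) ≤
        (2 : ℝ≥0∞) ^ ((3 : ℝ) - 1) * (‖w k z.1 z.2‖ₑ ^ (3 : ℕ) + ‖w k z.1 z.2 - u z.1 z.2‖ₑ ^ (3 : ℕ)) := by
      intro z
      have hsub : ‖u z.1 z.2‖ₑ ≤ ‖w k z.1 z.2‖ₑ + ‖w k z.1 z.2 - u z.1 z.2‖ₑ := by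
        have e : u z.1 z.2 = w k z.1 z.2 - (w k z.1 z.2 - u z.1 z.2) := by rw [sub_sub_cancel]
        calc ‖u z.1 z.2‖ₑ = ‖w k z.1 z.2 - (w k z.1 z.2 - u z.1 z.2)‖ₑ := by rw [← e]
          _ ≤ ‖w k z.1 z.2‖ₑ + ‖w k z.1 z.2 - u z.1 z.2‖ₑ := enorm_sub_le
      have h := ENNReal.rpow_add_le_mul_rpow_add_rpow (‖w k z.1 z.2‖ₑ) (‖w k z.1 z.2 - u z.1 z.2‖ₑ)
        (by norm_num : (1 : ℝ) ≤ 3)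
      rw [show ((3 : ℝ)) = ((3 : ℕ) : ℝ) by norm_num, ENNReal.rpow_natCast, ENNReal.rpow_natCast,
        ENNReal.rpow_natCast] at h
      exact (pow_le_pow_left' hsub 3).trans (by exact_mod_cast h)
    calc ∫⁻ z in Ioo 0 T₀ ×ˢ ball (0 : EuclideanSpace ℝ (Fin 3)) R, ‖u z.1 z.2‖ₑ ^ (3 : ℕ)
        ≤ ∫⁻ z in Ioo 0 T₀ ×ˢ ball (0 : EuclideanSpace ℝ (Fin 3)) R, (2 : ℝ≥0∞) ^ ((3 : ℝ) - 1) *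
            (‖w k z.1 z.2‖ₑ ^ (3 : ℕ) + ‖w k z.1 z.2 - u z.1 z.2‖ₑ ^ (3 : ℕ)) := lintegral_mono hpt
      _ = (2 : ℝ≥0∞) ^ ((3 : ℝ) - 1) *
            ((∫⁻ z in Ioo 0 T₀ ×ˢ ball (0 : EuclideanSpace ℝ (Fin 3)) R, ‖w k z.1 z.2‖ₑ ^ (3 : ℕ)) +
              ∫⁻ z in Ioo 0 T₀ ×ˢ ball (0 : EuclideanSpace ℝ (Fin 3)) R,
                ‖w k z.1 z.2 - u z.1 z.2‖ₑ ^ (3 : ℕ)) := by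
          have hsum : AEMeasurable (fun z : ℝ × EuclideanSpace ℝ (Fin 3) =>
              ‖w k z.1 z.2‖ₑ ^ (3 : ℕ) + ‖w k z.1 z.2 - u z.1 z.2‖ₑ ^ (3 : ℕ)) μB := hwe.add hde
          rw [lintegral_const_mul'' _ hsum, lintegral_add_left' hwe]
      _ < ∞ := ENNReal.mul_lt_top (ENNReal.rpow_lt_top_of_nonneg (by norm_num) ENNReal.ofNat_ne_top)
          (ENNReal.add_lt_top.2 ⟨h3k, hk.trans ENNReal.one_lt_top⟩)
  -- the pressure-gradient functional of the limit vanishes, hence (7.3.10) slice-wise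
  have hF := fun (δ : ℝ) (hδ : 0 < δ) (η' : ℝ → ℝ) (hη' : ContDiff ℝ (⊤ : ℕ∞) η')
      (hη'c : HasCompactSupport η') (hη'T : tsupport η' ⊆ Ioo 0 T₀) (c₀ e : EuclideanSpace ℝ (Fin 3)) =>
    Seregin2014Limit.limit_pgFunctional_eq_zero C hw hwC hpl hum huA hL2 hpress hδ hη' hη'c hη'T c₀ e
  have hexp := Seregin2014Limit.limit_ae_slice_pressure_expansion hum hpm hp ENNReal.coe_ne_top huA
    hu3 hF
  have hdecay := seregin2014_limit_decay_holds hν hT₀ C aL u p (memE2_of_memLp haL.1 (by norm_num) (by norm_num)) haLdiv hsuit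
    hp hmeas huC huG hwc hinit (fun x₀ r hr => hexp.mono fun t ht => ht x₀ r hr)
  -- ### Step 6: "Thus, `v_∞` is a local Leray solution" — on `[0, T₀]`, then on `[0, T₁]`
  have hsol : IsLocalEnergySolutionOn T₀ ν aL u p :=
    { suitable := hsuit
      pressure := hp
      sliceMeasurable := hmeas
      uniformLocalEnergy := ⟨C, huC⟩
      uniformLocalGradient := huG.imp fun G hG' => ⟨hG'.1, C, hG'.2⟩
      weakContinuous := hwc
      initial := hinit
      decay := hdecay }
  refine ⟨φ, aL, u, p, hφ, haL.1, hofM ▸ haL.2, haLdiv, hsol, huC, huG, ?_, hL2⟩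
  exact fun t ht ψ hψ => hpt t ht ψ hψ

/-! ### §4: the core — an `L³` bound along `t_k ↑ T` rules out singular points at time `T` -/

/-- **Seregin's theorem, core form for energy solutions** (Seregin 2012, §2 first paragraph and
§§2–4; Seregin 2014, Ch. 7): let `u` be a Leray–Hopf weak solution on `ℝ³ × [0, T)` with
viscosity `ν > 0`, all of whose points in the open strip `0 < t < T` are regular, and suppose
`‖u(t)‖₃ ≤ M` frequently as `t ↑ T`. Then every point `(T, x₀)` is regular: `u` is essentially
bounded on some `Q_r(T, x₀)`. Conditional on **U** (`local_leray_weak_strong_uniqueness`,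
Lemarié-Rieusset 2016, Thm. 14.7, used through Thm. 15.4
`lemarieRieusset_backward_uniqueness_slab_of_U_S`) and on the uniform initial layer of local
energy solutions with `L³` data on short strips (`hlayer`: Jia–Šverák 2013, Lemma 8 = Seregin 2012,
(2.13), on a slab; every-time form). Proof: the module docstring (Seregin's §§2–4 with the
approximants of `NSSereginEnergyApproximants.lean`).
[cite: Seregin2012CMP, §§2–4, proof of Thm. 1.1] [cite: Seregin2014, Ch. 7, proof of Thm. 1.1] [cite: LemarieRieusset2016, Thm. 15.4 and proof of Thm. 15.5, pp. 568–573] -/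
theorem isRegular_finalTime_of_frequently_eLpNorm_three_le
    (hU : local_leray_weak_strong_uniqueness)
    (hlayer : ∀ M : ℝ≥0, ∃ S₁ : ℝ, 0 < S₁ ∧ ∀ T : ℝ, 0 < T → T ≤ S₁ →
      ∃ η : ℝ → ℝ≥0, Tendsto η (𝓝[>] 0) (𝓝 0) ∧
      ∀ (a : EuclideanSpace ℝ (Fin 3) → EuclideanSpace ℝ (Fin 3))
        (v : ℝ → EuclideanSpace ℝ (Fin 3) → EuclideanSpace ℝ (Fin 3))
        (π : ℝ → EuclideanSpace ℝ (Fin 3) → ℝ),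
        MemLp a 3 volume → eLpNorm a 3 volume ≤ M → IsLocalEnergySolutionOn T 1 a v π →
        ∀ t ∈ Ioo 0 T, ∀ x₀ : EuclideanSpace ℝ (Fin 3),
          eLpNorm (v t - heatTest 1 a t) 2 (volume.restrict (ball x₀ 1)) ≤ η t)
    {ν T : ℝ} (hν : 0 < ν) (hT : 0 < T)
    {u₀ : EuclideanSpace ℝ (Fin 3) → EuclideanSpace ℝ (Fin 3)}
    {u : ℝ → EuclideanSpace ℝ (Fin 3) → EuclideanSpace ℝ (Fin 3)}
    (hLHT : IsLerayHopfOn T ν 0 u₀ u)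
    (hreg : ∀ t ∈ Ioo 0 T, ∀ x : EuclideanSpace ℝ (Fin 3), IsRegularPoint u (t, x))
    (hlim : ∃ M : ℝ≥0, ∃ᶠ t in 𝓝[<] T, eLpNorm (u t) 3 volume ≤ M)
    (x₀ : EuclideanSpace ℝ (Fin 3)) :
    ∃ r : ℝ, 0 < r ∧
      eLpNorm (uncurry u) ∞ (volume.restrict (parabolicCylinder r ((T : ℝ), x₀))) < ∞ := by
  obtain ⟨M, hfreq⟩ := hlim
  -- ### times `t_n ↑ T` in `(0, T)` with `‖u(t_n)‖₃ ≤ M`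
  obtain ⟨t, ht, htI, htM⟩ : ∃ t : ℕ → ℝ, Tendsto t atTop (𝓝 T) ∧ (∀ n, t n ∈ Ioo 0 T) ∧
      ∀ n, eLpNorm (u (t n)) 3 volume ≤ M := by
    have hfreq' : ∃ᶠ s in 𝓝[<] T, s ∈ Ioo 0 T ∧ eLpNorm (u s) 3 volume ≤ M :=
      (hfreq.and_eventually (Ioo_mem_nhdsLT hT)).mono fun s hs => ⟨hs.2, hs.1⟩
    obtain ⟨t, ht, hprop⟩ := exists_seq_forall_of_frequently hfreq'
    exact ⟨t, ht.mono_right nhdsWithin_le_nhds, fun n => (hprop n).1, fun n => (hprop n).2⟩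
  have hmem3 : ∀ n, MemLp (u (t n)) 3 volume := fun n =>
    ⟨(hLHT.memLp (t n) ⟨(htI n).1.le, (htI n).2.le⟩).1, (htM n).trans_lt ENNReal.coe_lt_top⟩
  -- ### (2.2): `u(T) ∈ L³`, `‖u(T)‖₃ ≤ M` (weak limit of `u(t_n)` in `L²`, duality)
  have huT : MemLp (u T) 3 volume ∧ eLpNorm (u T) 3 volume ≤ (M : ℝ≥0∞) := by
    have hT2 : MemLp (u T) 2 volume := hLHT.memLp T ⟨hT.le, le_rfl⟩
    have h := FunctionSpaces.memLp_three_of_forall_abs_integral_inner_le hT2.1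
      ((memLp_two_iff_integrable_sq_norm hT2.1).1 hT2).locallyIntegrable M.coe_nonneg ?_
    · rwa [ENNReal.ofReal_coe_nnreal] at h
    intro ψ hψ
    have hψ2 : MemLp ψ 2 volume :=
      hψ.contDiff.continuous.memLp_of_hasCompactSupport hψ.hasCompactSupport
    have hψq : MemLp ψ (3 / 2 : ℝ≥0∞) volume :=
      hψ.contDiff.continuous.memLp_of_hasCompactSupport hψ.hasCompactSupport
    have hconv : Tendsto (fun n => ∫ x, ⟪u (t n) x, ψ x⟫) atTop (𝓝 (∫ x, ⟪u T x, ψ x⟫)) := by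
      have hc := (hLHT.weak_continuous ψ hψ2).1 T ⟨hT, le_rfl⟩
      have ht' : Tendsto t atTop (𝓝[Ioc 0 T] T) :=
        tendsto_nhdsWithin_iff.2 ⟨ht, Eventually.of_forall fun n => ⟨(htI n).1, (htI n).2.le⟩⟩
      exact hc.tendsto.comp ht'
    have hbd : ∀ n, |∫ x, ⟪u (t n) x, ψ x⟫| ≤ M * (eLpNorm ψ (3 / 2 : ℝ≥0∞) volume).toReal :=
      fun n => (abs_integral_inner_le_eLpNorm_three_mul (hmem3 n) hψq).trans
        (mul_le_mul_of_nonneg_right (ENNReal.toReal_le_coe_of_le_coe (htM n)) ENNReal.toReal_nonneg)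
    exact le_of_tendsto ((continuous_abs.tendsto _).comp hconv) (Eventually.of_forall hbd)
  -- ### constants: `M₁ = M/ν`, the strip length `S`, the layer function `η`
  set M₁ : ℝ≥0 := (ν⁻¹).toNNReal * M with hM₁
  have hM₁coe : (M₁ : ℝ≥0∞) = ENNReal.ofReal ν⁻¹ * M := by
    rw [hM₁, ENNReal.coe_mul, ENNReal.ofReal]
  obtain ⟨S₀, B, hS₀, -, hbounds⟩ := exists_localEnergy_bounds_of_L3_data
  obtain ⟨S₁, hS₁, hlayS⟩ := hlayer M₁
  set S : ℝ := min (S₀ M₁) S₁ with hS_def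
  have hS : 0 < S := lt_min (hS₀ M₁) hS₁
  have hSS₀ : S ≤ S₀ M₁ := min_le_left _ _
  have hSS₁ : S ≤ S₁ := min_le_right _ _
  obtain ⟨η, hη, hlay⟩ := hlayS S hS hSS₁
  -- ### the scales `λ_n`, `λ_n² = ν (T − t_n) / S → 0`
  set lam : ℕ → ℝ := fun n => Real.sqrt (ν * (T - t n) / S) with hlam_def
  have hTt : ∀ n, 0 < T - t n := fun n => by linarith [(htI n).2]
  have hlam : ∀ n, 0 < lam n := fun n => Real.sqrt_pos.2 (by have := hTt n; positivity)
  have hlam2 : ∀ n, lam n ^ 2 = ν * (T - t n) / S := fun n =>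
    Real.sq_sqrt (by have := hTt n; positivity)
  have hstrip : ∀ n, ν * (T - t n) / lam n ^ 2 = S := fun n => by
    rw [hlam2]
    have := hTt n
    field_simp
  have hfinalTime : ∀ n, t n + lam n ^ 2 / ν * S = T := fun n => by
    rw [hlam2]
    field_simp
    ring
  have hlam0 : Tendsto lam atTop (𝓝 0) := by
    have h1 : Tendsto (fun n => ν * (T - t n) / S) atTop (𝓝 (ν * (T - T) / S)) :=
      ((tendsto_const_nhds.sub ht).const_mul ν).div_const S
    rw [sub_self, mul_zero, zero_div] at h1
    have h2 := h1.sqrt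
    rwa [Real.sqrt_zero] at h2
  -- ### §2: the approximants (rescaled restarts, unit viscosity) on `[0, S]`
  set a : ℕ → EuclideanSpace ℝ (Fin 3) → EuclideanSpace ℝ (Fin 3) :=
    fun n y => (lam n / ν) • u (t n) (x₀ + lam n • y) with ha_def
  set v : ℕ → ℝ → EuclideanSpace ℝ (Fin 3) → EuclideanSpace ℝ (Fin 3) :=
    fun n s y => (lam n / ν) • u (t n + lam n ^ 2 / ν * s) (x₀ + lam n • y) with hv_def
  have hex : ∀ n, ∃ π : ℝ → EuclideanSpace ℝ (Fin 3) → ℝ,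
      IsLocalEnergySolutionOn S 1 (a n) (v n) π := fun n => by
    obtain ⟨π, hπ⟩ := hLHT.exists_isLocalEnergySolutionOn_rescaled_restart hν hT hreg (htI n)
      (hlam n) x₀
    rw [hstrip n] at hπ
    exact ⟨π, hπ⟩
  choose π hv using hex
  -- the data: in `L³` with `‖a_n‖₃ ≤ M₁`, weakly divergence free
  have ha3 : ∀ n, MemLp (a n) 3 volume := fun n =>
    memLp_three_smul_comp_affine (hmem3 n) hν (hlam n) x₀
  have haM : ∀ n, eLpNorm (a n) 3 volume ≤ (M₁ : ℝ≥0∞) := fun n => by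
    show eLpNorm (fun y => (lam n / ν) • u (t n) (x₀ + lam n • y)) 3 volume ≤ _
    rw [eLpNorm_three_smul_comp_affine _ hν (hlam n) x₀, hM₁coe]
    gcongr
    exact htM n
  have haM' : ∀ n, eLpNorm (a n) 3 volume ≤ ENNReal.ofReal (M₁ : ℝ) := fun n => by
    rw [ENNReal.ofReal_coe_nnreal]; exact haM n
  have hadiv : ∀ n, IsWeaklyDivFree (a n) := fun n => (hv n).isWeaklyDivFree_datum hS
  -- ### uniform bounds on `[0, S]`
  have hB : ∀ n, _ := fun n => hbounds M₁ S (a n) (v n) (π n) hS hSS₀ (ha3 n) (haM n) (hv n)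
  -- the slice at the final time: `v_n(S) = (λ_n/ν) u(T, x₀ + λ_n ·)`
  have hvS : ∀ n, v n S = fun y => (lam n / ν) • u T (x₀ + lam n • y) := fun n => by
    funext y
    show (lam n / ν) • u (t n + lam n ^ 2 / ν * S) (x₀ + lam n • y) = _
    rw [hfinalTime n]
  have hvS3 : ∀ n, MemLp (v n S) 3 volume := fun n => by
    rw [hvS n]; exact memLp_three_smul_comp_affine huT.1 hν (hlam n) x₀
  have hvSM : ∀ n, eLpNorm (v n S) 3 volume ≤ (M₁ : ℝ≥0∞) := fun n => by
    rw [hvS n, eLpNorm_three_smul_comp_affine _ hν (hlam n) x₀, hM₁coe]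
    gcongr
    exact huT.2
  have hvSball : ∀ n, ∀ y : EuclideanSpace ℝ (Fin 3),
      ∫⁻ x in ball y 1, ‖v n S x‖ₑ ^ 2 ≤ ((2 * M₁ ^ 2 : ℝ≥0) : ℝ≥0∞) := by
    intro n y
    refine (lintegral_ball_enorm_sq_le_two_mul (hvS3 n) y zero_le_one).trans ?_
    have h1 : (eLpNorm (v n S) 3 volume).toNNReal ≤ M₁ := by
      rw [← ENNReal.coe_le_coe, ENNReal.coe_toNNReal (hvS3 n).eLpNorm_ne_top]
      exact hvSM n
    push_cast
    rw [Real.toNNReal_one, ENNReal.coe_one, mul_one]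
    gcongr
  set C : ℝ≥0 := B M₁ + 2 * M₁ ^ 2 with hC_def
  have hCall : ∀ n, ∀ s ∈ Icc 0 S, ∀ y : EuclideanSpace ℝ (Fin 3),
      ∫⁻ x in ball y 1, ‖v n s x‖ₑ ^ 2 ≤ C := by
    intro n s hs y
    rcases hs.2.eq_or_lt with h | h
    · rw [h]
      refine (hvSball n y).trans ?_
      exact_mod_cast le_add_self
    · refine ((hB n).2.1 s ⟨hs.1, h⟩ y).trans ?_
      exact_mod_cast le_self_add
  have hCae : ∀ n, ∀ᵐ s ∂(volume.restrict (Ioo (0 : ℝ) S)), ∀ y : EuclideanSpace ℝ (Fin 3),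
      ∫⁻ x in ball y 1, ‖v n s x‖ₑ ^ 2 ≤ C := fun n =>
    (ae_restrict_mem measurableSet_Ioo).mono fun s hs y => hCall n s ⟨hs.1.le, hs.2.le⟩ y
  have hGall : ∀ n, ∃ G : ℝ → EuclideanSpace ℝ (Fin 3) →
        EuclideanSpace ℝ (Fin 3) →L[ℝ] EuclideanSpace ℝ (Fin 3),
      HasWeakSpatialGradientOn (slab (EuclideanSpace ℝ (Fin 3)) (Ioo 0 S) isOpen_Ioo) (v n) G ∧
        ∀ y : EuclideanSpace ℝ (Fin 3), ∫⁻ z in Ioo 0 S ×ˢ ball y 1,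
          ENNReal.ofReal (frobeniusNormSq (G z.1 z.2)) ≤ C := fun n => by
    obtain ⟨G, hG, hGb⟩ := (hB n).2.2
    exact ⟨G, hG, fun y => (hGb y).trans (by exact_mod_cast le_self_add)⟩
  -- ### the uniform initial layer (hypothesis `hlayer`)
  have hlayall : ∀ n, ∀ s ∈ Ioo 0 S, ∀ y : EuclideanSpace ℝ (Fin 3),
      eLpNorm (v n s - heatTest 1 (a n) s) 2 (volume.restrict (ball y 1)) ≤ η s :=
    fun n s hs y => hlay (a n) (v n) (π n) (ha3 n) (haM n) (hv n) s hs y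
  -- ### §3: the limit on `[0, S]`
  obtain ⟨φ, aL, vL, πL, hφ, haL, -, haLdiv, hsol, -, -, hpt, hL2⟩ :=
    localEnergy_compactness_sameInterval one_pos hS (M₁ : ℝ) C η hη a v π
      (fun n => ⟨ha3 n, haM' n, hadiv n⟩) hv hCall hGall hlayall
  -- ### (4.2): the limit vanishes at the final time, since `u(T) ∈ L³`
  have hzero : ∀ ψ : EuclideanSpace ℝ (Fin 3) → EuclideanSpace ℝ (Fin 3),
      FunctionSpaces.IsTestFunctionOn (⊤ : Opens (EuclideanSpace ℝ (Fin 3))) ψ →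
        ∫ x, ⟪vL S x, ψ x⟫ = 0 := by
    intro ψ hψ
    have h1 := hpt S ⟨hS.le, le_rfl⟩ ψ hψ
    have hc0 : Tendsto (lam ∘ φ) atTop (𝓝 0) := hlam0.comp hφ.tendsto_atTop
    have h3 := tendsto_integral_inner_blowup_of_memLp_three (E := EuclideanSpace ℝ (Fin 3))
      finrank_euclideanSpace_fin huT.1 hψ x₀ (c := lam ∘ φ) (fun k => hlam (φ k)) hc0
    have e : ∀ k, ∫ x, ⟪v (φ k) S x, ψ x⟫ =
        ν⁻¹ * ∫ x, ⟪(lam ∘ φ) k • u T (x₀ + (lam ∘ φ) k • x), ψ x⟫ := fun k => by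
      rw [hvS, ← integral_const_mul]
      refine integral_congr_ae (Eventually.of_forall fun x => ?_)
      simp only [Function.comp_apply, real_inner_smul_left]
      rw [div_eq_inv_mul]
      ring
    have h2 : Tendsto (fun k => ∫ x, ⟪v (φ k) S x, ψ x⟫) atTop (𝓝 0) := by
      simp_rw [e]
      have h4 := h3.const_mul ν⁻¹
      rwa [mul_zero] at h4
    exact tendsto_nhds_unique h1 h2
  have hfinal : ∀ ψ : EuclideanSpace ℝ (Fin 3) → EuclideanSpace ℝ (Fin 3),
      FunctionSpaces.IsTestFunctionOn (⊤ : Opens (EuclideanSpace ℝ (Fin 3))) ψ →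
        Tendsto (fun s => ∫ x, ⟪vL s x, ψ x⟫) (𝓝[<] S) (𝓝 0) := by
    intro ψ hψ
    have hc := (hsol.weakContinuous ψ hψ) S ⟨hS.le, le_rfl⟩
    rw [← hzero ψ hψ]
    refine hc.tendsto.mono_left ?_
    calc 𝓝[<] S = 𝓝[Ioi 0 ∩ Iio S] S :=
          (nhdsWithin_inter_of_mem (mem_nhdsWithin_of_mem_nhds (Ioi_mem_nhds hS))).symm
      _ ≤ 𝓝[Icc 0 S] S := nhdsWithin_mono _ fun s hs => ⟨le_of_lt hs.1, le_of_lt hs.2⟩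
  -- ### backward uniqueness (Lemarié-Rieusset's Thm. 15.4, from U and S): `v_∞ = 0`
  have hvan : ∀ᵐ z ∂(volume.restrict (Ioo 0 S ×ˢ (univ : Set (EuclideanSpace ℝ (Fin 3))))),
      vL z.1 z.2 = 0 :=
    lemarieRieusset_backward_uniqueness_slab_of_U_S hU NSBoundedHigherRegularityBounds_holds
      one_pos hS haL haLdiv hsol.isLocalLeraySolutionOn hfinal
  -- hence `v_∞` is bounded on `Q_{r₀}(S, 0)`, `r₀ = √S / 2`
  set r₀ : ℝ := Real.sqrt S / 2 with hr₀_def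
  have hr₀ : 0 < r₀ := by positivity
  have hr₀S : r₀ ^ 2 < S := by
    rw [hr₀_def, div_pow, Real.sq_sqrt hS.le]
    linarith
  have hQsub : parabolicCylinder r₀ ((S : ℝ), (0 : EuclideanSpace ℝ (Fin 3))) ⊆
      Ioo 0 S ×ˢ (univ : Set (EuclideanSpace ℝ (Fin 3))) := fun z hz =>
    ⟨⟨by have h1 := hz.1.1; simp only at h1; linarith, hz.1.2⟩, mem_univ _⟩
  have hregL : eLpNorm (uncurry vL) ∞
      (volume.restrict (parabolicCylinder r₀ ((S : ℝ), (0 : EuclideanSpace ℝ (Fin 3))))) < ∞ := by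
    have h0 : uncurry vL =ᵐ[volume.restrict (parabolicCylinder r₀ ((S : ℝ), (0 : EuclideanSpace ℝ (Fin 3))))]
        (0 : ℝ × EuclideanSpace ℝ (Fin 3) → EuclideanSpace ℝ (Fin 3)) :=
      (ae_restrict_of_ae_restrict_of_subset hQsub hvan).mono fun z hz => hz
    rw [eLpNorm_congr_ae h0, eLpNorm_zero]
    exact ENNReal.zero_lt_top
  -- ### stability of singular points at the final time: the approximants are bounded near `(S, 0)`
  obtain ⟨r₁, hr₁, hev⟩ := lemarieRieusset_singular_point_stability_holds one_pos hS C
    (fun k => a (φ k)) (fun k => v (φ k)) (fun k => π (φ k)) aL vL πL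
    (fun k => (hv (φ k)).isLocalLeraySolutionOn) hsol.isLocalLeraySolutionOn
    (fun k => hCae (φ k)) (fun k => hGall (φ k)) hL2 0 ⟨r₀, hr₀, hr₀S, hregL⟩
  obtain ⟨k, hk⟩ := hev.exists
  -- ### inverse scaling: `u` is bounded on a parabolic cylinder about `(T, x₀)`
  have hk' : eLpNorm (uncurry fun s y => (lam (φ k) / ν) • u (t (φ k) + lam (φ k) ^ 2 / ν * s)
      (x₀ + lam (φ k) • y)) ∞
      (volume.restrict (parabolicCylinder r₁ ((S : ℝ), (0 : EuclideanSpace ℝ (Fin 3))))) < ∞ := hk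
  have h := eLpNorm_top_parabolicCylinder_lt_top_of_rescaled u hν (hlam (φ k)) (t (φ k)) S x₀ hr₁ hk'
  rw [hfinalTime (φ k)] at h
  exact ⟨_, div_pos (mul_pos (hlam _) hr₁) (by positivity), h⟩

/-! ### Thm. 1.1 in the tree's form (ns.S08) from U and the slab initial layer -/

/-- **Seregin 2012, Thm. 1.1 (`seregin_L3_blowup`, ns.S08) from `local_leray_weak_strong_uniqueness`
(Lemarié-Rieusset 2016, Thm. 14.7) and the uniform initial layer of local energy solutions with
`L³` data on short strips** (Jia–Šverák 2013, Lemma 8 = Seregin 2012, (2.13), slab form). Proof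
(Seregin 2012, §2, first paragraph, and the last paragraph of the proof of Thm. 1.1, p. 6): the
maximal smooth Leray–Hopf solution `u`, bounded on closed sub-strips, is a Kato solution in
`C([0,T); L³)` whose lifespan `T` is maximal (a longer Kato solution is smooth,
`mild_L3_smooth_holds`, and would continue `u` classically — as in `seregin_L3_blowup_of_mild`,
whose identification is repeated here), so by Lemarié-Rieusset's Thm. 15.1 (C)
(`lemarieRieusset_singular_point_of_blowup_holds`) some `(T, x₀)` is singular; if
`‖u(t)‖₃ ↛ ∞`, then `‖u(t)‖₃ ≤ M` frequently as `t ↑ T` and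
`isRegular_finalTime_of_frequently_eLpNorm_three_le` makes `(T, x₀)` regular — "So, `z_T` is
not a singular point", a contradiction.
[cite: Seregin2012CMP, Thm. 1.1 and its proof, §§2–4] [cite: LemarieRieusset2016, Thm. 15.1 (C), Thm. 14.7, Thm. 15.4] -/
theorem seregin_L3_blowup_of_U_of_layer (hU : local_leray_weak_strong_uniqueness)
    (hlayer : ∀ M : ℝ≥0, ∃ S₁ : ℝ, 0 < S₁ ∧ ∀ T : ℝ, 0 < T → T ≤ S₁ →
      ∃ η : ℝ → ℝ≥0, Tendsto η (𝓝[>] 0) (𝓝 0) ∧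
      ∀ (a : EuclideanSpace ℝ (Fin 3) → EuclideanSpace ℝ (Fin 3))
        (v : ℝ → EuclideanSpace ℝ (Fin 3) → EuclideanSpace ℝ (Fin 3))
        (π : ℝ → EuclideanSpace ℝ (Fin 3) → ℝ),
        MemLp a 3 volume → eLpNorm a 3 volume ≤ M → IsLocalEnergySolutionOn T 1 a v π →
        ∀ t ∈ Ioo 0 T, ∀ x₀ : EuclideanSpace ℝ (Fin 3),
          eLpNorm (v t - heatTest 1 a t) 2 (volume.restrict (ball x₀ 1)) ≤ η t) :
    seregin_L3_blowup := by
  intro ν T hν hT u p hmax hlh h₃ hbdd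
  have hcl : FluidPDE.IsClassicalNSSolutionOn (Ico 0 T) ν 0 u p := hmax.1
  have hcont : ContinuousOn (uncurry u) (Ico 0 T ×ˢ univ) := hcl.smooth_velocity.continuousOn
  have hslice : ∀ t ∈ Ico 0 T, AEStronglyMeasurable (u t) volume := fun t ht =>
    (hcl.contDiff_velocity ht).continuous.aestronglyMeasurable
  have hdiv0 : FluidPDE.IsWeaklyDivFree (u 0) := hlh.isWeaklyDivFree_datum hT
  have hu02 : MemLp (u 0) 2 volume := hlh.memLp 0 ⟨le_rfl, hT.le⟩
  -- (i) pointwise bounds on closed sub-strips and the `L²` bound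
  have hbound : ∀ T' ∈ Ioo 0 T, ∃ M : ℝ, ∀ t ∈ Icc 0 T', ∀ x, ‖u t x‖ ≤ M := fun T' hT' =>
    exists_bound_Icc_of_eLpNorm_top hT' hcont hbdd
  set C₀ : ℝ≥0∞ := ENNReal.ofReal (2 * VectorCalculus.kineticEnergy (u 0)) ^ (2⁻¹ : ℝ) with hC₀
  have hC₀top : C₀ ≠ ∞ := ENNReal.rpow_ne_top_of_nonneg (by norm_num) ENNReal.ofReal_ne_top
  have hE : ∀ t ∈ Icc 0 T, eLpNorm (u t) 2 volume ≤ C₀ := fun t ht =>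
    eLpNorm_two_le_of_isLerayHopfOn hν.le hlh ht
  -- every `t < T` lies in a closed sub-strip `[0, T']`, `t < T' < T`
  have hsub : ∀ t ∈ Ico 0 T, ∃ T' ∈ Ioo 0 T, t < T' := fun t ht =>
    ⟨(t + T) / 2, ⟨by linarith [ht.1], by linarith [ht.2]⟩, by linarith [ht.2]⟩
  -- (ii) `u` is a mild solution on `[0, T)` (Leray–Hopf ⇒ mild on `(0, T]`; at `t = 0` the duality
  -- identity is the weak initial condition, trivial for the datum `u 0`) …
  have hmildT : FluidPDE.IsMildNSSolutionOn (Ioc 0 T) ν 0 (u 0) u :=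
    isMildNSSolutionOn_of_isLerayHopfOn_holds hν hT hu02 hlh
  have hmild : FluidPDE.IsMildNSSolutionOn (Ico 0 T) ν 0 (u 0) u := by
    refine ⟨fun t ht => ?_, fun t ht => ?_⟩
    · rcases ht.1.eq_or_lt with h0 | hpos
      · rw [← h0]; exact hdiv0
      · exact hmildT.1 t ⟨hpos, ht.2.le⟩
    · rcases ht.1.eq_or_lt with h0 | hpos
      · rw [← h0]; exact FluidPDE.isMildNSSolutionFrom_zero_iff.2 fun φ _ _ => rfl
      · exact hmildT.2 t ⟨hpos, ht.2.le⟩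
  -- … with slices in `L³` …
  have hmem3 : ∀ t ∈ Ico 0 T, MemLp (u t) 3 volume := by
    intro t ht
    obtain ⟨T', hT', htT'⟩ := hsub t ht
    obtain ⟨M, hMb⟩ := hbound T' hT'
    have hle : eLpNorm (u t) 3 volume ^ 3 ≤ ENNReal.ofReal M * C₀ ^ 2 :=
      (eLpNorm_three_pow_le (hslice t ht)).trans (by
        gcongr
        exacts [eLpNorm_top_le_of_bound (hMb t ⟨ht.1, htT'.le⟩), hE t ⟨ht.1, ht.2.le⟩])
    have hlt : eLpNorm (u t) 3 volume ^ 3 < ∞ :=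
      lt_of_le_of_lt hle
        (ENNReal.mul_lt_top ENNReal.ofReal_lt_top (ENNReal.pow_lt_top hC₀top.lt_top))
    exact ⟨hslice t ht, (ENNReal.pow_lt_top_iff.1 hlt).resolve_right (by norm_num)⟩
  -- … strongly `L²`-continuous at positive times (Sather–Serrin with `q = r = ∞` on `(0, T']`) …
  have hC2 : ∀ T' ∈ Ioo 0 T, FluidPDE.ContinuousInLpOn (Ioc 0 T') 2 u := by
    intro T' hT'
    obtain ⟨M, hMb⟩ := hbound T' hT'
    have htop : FluidPDE.MemLqLp ∞ ∞ u (Ioo 0 T') :=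
      memLqLp_top_top_of_bound (fun t ht => hslice t ⟨ht.1, ht.2.trans_lt hT'.2⟩) hMb
    exact continuousInLpOn_two_of_serrin hν hT'.1 (hlh.of_le hT'.2.le) hu02 (q := ∞) (r := ∞)
      (ENNReal.ofNat_lt_top) (by simp [ENNReal.div_top]) htop
  -- … hence continuous into `L³` on `[0, T)`
  have hC3 : FluidPDE.ContinuousInLpOn (Ico 0 T) 3 u := by
    refine ⟨hmem3, fun t₀ ht₀ => ?_⟩
    obtain ⟨T', hT', ht₀T'⟩ := hsub t₀ ht₀
    obtain ⟨M, hMb⟩ := hbound T' hT'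
    -- `L²`-continuity at `t₀` within `[0, T')`
    have h2 : Tendsto (fun t => eLpNorm (u t - u t₀) 2 volume) (𝓝[Ico 0 T'] t₀) (𝓝 0) := by
      rcases ht₀.1.eq_or_lt with h0 | hpos
      · -- `t₀ = 0`: strong attainment of the datum `u 0`
        subst h0
        have hs : Tendsto (fun t => eLpNorm (u t - u 0) 2 volume) (𝓝[Ioo 0 T'] 0) (𝓝 0) :=
          hlh.strong_initial.mono_left (nhdsWithin_mono _ fun t ht => ht.1)
        have hp : Tendsto (fun t => eLpNorm (u t - u 0) 2 volume) (pure 0) (𝓝 0) := by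
          simpa using tendsto_pure_nhds (fun t => eLpNorm (u t - u 0) 2 volume) 0
        rw [← Ioo_insert_left hT'.1, nhdsWithin_insert]
        exact hp.sup hs
      · have hc := ((hC2 T' hT').2 t₀ ⟨hpos, ht₀T'.le⟩).mono_left
          (nhdsWithin_mono t₀ (Ioo_subset_Ioc_self : Ioo 0 T' ⊆ Ioc 0 T'))
        have heq : 𝓝[Ico 0 T'] t₀ = 𝓝[Ioo 0 T'] t₀ := by
          rw [← nhdsWithin_inter_of_mem' (mem_nhdsWithin_of_mem_nhds (Ioi_mem_nhds hpos))]
          congr 1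
          ext s
          exact ⟨fun h => ⟨h.2, h.1.2⟩, fun h => ⟨⟨h.1.le, h.2⟩, h.1⟩⟩
        rwa [heq]
    -- `L³`-continuity within `[0, T')`, then within `[0, T)`
    have h3 := tendsto_eLpNorm_three_of_two (S := Ico 0 T')
      (fun t ht => hslice t ⟨ht.1, ht.2.trans hT'.2⟩)
      (fun t ht x => hMb t (Ico_subset_Icc_self ht) x) ⟨ht₀.1, ht₀T'⟩ h2
    have heq2 : 𝓝[Ico 0 T] t₀ = 𝓝[Ico 0 T'] t₀ := by
      rw [← nhdsWithin_inter_of_mem' (mem_nhdsWithin_of_mem_nhds (Iio_mem_nhds ht₀T'))]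
      congr 1
      ext s
      exact ⟨fun h => ⟨h.1.1, h.2⟩, fun h => ⟨⟨h.1, h.2.trans hT'.2⟩, h.2⟩⟩
    rwa [heq2]
  -- measurability on `(0, T) × ℝ³`
  have hmeasT : AEStronglyMeasurable (uncurry u) (volume.restrict (Ioo 0 T ×ˢ univ)) :=
    (hcont.mono (prod_mono Ioo_subset_Ico_self Subset.rfl)).aestronglyMeasurable
      (measurableSet_Ioo.prod MeasurableSet.univ)
  -- (iii) `T` is the maximal existence time of `u` as a mild `C_t L³` solution
  have hmaxmild : ∀ T' : ℝ, T < T' → ∀ v : ℝ → ℝ³ → ℝ³,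
      FluidPDE.IsMildNSSolutionOn (Ico 0 T') ν 0 (u 0) v → FluidPDE.ContinuousInLpOn (Ico 0 T') 3 v →
      AEStronglyMeasurable (uncurry v) (volume.restrict (Ioo 0 T' ×ˢ univ)) → False := by
    intro T' hTT' v hv hvc hvm
    have hT'pos : 0 < T' := hT.trans hTT'
    -- uniqueness on `[0, T)`
    have hvm' : AEStronglyMeasurable (uncurry v) (volume.restrict (Ioo 0 T ×ˢ univ)) :=
      hvm.mono_measure (Measure.restrict_mono (prod_mono (Ioo_subset_Ioo_right hTT'.le)
        Subset.rfl) le_rfl)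
    have hae : ∀ t ∈ Ico 0 T, u t =ᵐ[volume] v t :=
      kato_unique_holds hν h₃ hmild (hv.mono (Ico_subset_Ico_right hTT'.le)) hC3
        (hvc.mono (Ico_subset_Ico_right hTT'.le)) hmeasT hvm'
    -- smoothness of `v` on `(0, T')`
    obtain ⟨w, π, hw, hwv⟩ := mild_L3_smooth_holds hν hT'pos h₃ hdiv0 hv hvc hvm
    -- `u = w` on `(0, T) × ℝ³`
    have heq : ∀ t ∈ Ioo 0 T, u t = w t := by
      intro t ht
      have h1 : u t =ᵐ[volume] w t :=
        (hae t ⟨ht.1.le, ht.2⟩).trans (hwv t ⟨ht.1, ht.2.trans hTT'⟩).symm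
      exact (Continuous.ae_eq_iff_eq volume (hcl.contDiff_velocity ⟨ht.1.le, ht.2⟩).continuous
        (hw.contDiff_velocity ⟨ht.1, ht.2.trans hTT'⟩).continuous).1 h1
    -- glue to a classical continuation past `T`
    have hglue := hcl.glue hw le_rfl hT hTT'.le heq
    exact hmax.2 ⟨T', hTT', _, _, hglue, fun t ht => if_pos ht.2⟩
  -- (iv) `u` is a Kato solution on `[0, T)` with maximal lifespan, hence has a singular point at `T`
  have hK : IsKatoSolutionOn T ν (u 0) u := ⟨hmild, hC3, rfl, hmeasT⟩
  have hmax' : ∀ T' : ℝ, T < T' →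
      ∀ v : ℝ → ℝ³ → ℝ³, ¬ IsKatoSolutionOn T' ν (u 0) v := fun T' hT' v hv =>
    hmaxmild T' hT' v hv.mild hv.continuousInLpOn hv.aestronglyMeasurable
  obtain ⟨x₀, hx₀⟩ := lemarieRieusset_singular_point_of_blowup_holds hν hT h₃ hdiv0 hK hmax'
  -- (v) if `‖u(t)‖₃ ↛ ∞`, the core makes `(T, x₀)` regular — contradiction
  rw [ENNReal.tendsto_nhds_top_iff_nnreal]
  by_contra hnot
  obtain ⟨M, hM⟩ := not_forall.1 hnot
  have hfreq : ∃ᶠ t in 𝓝[<] T, eLpNorm (u t) 3 volume ≤ M :=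
    (not_eventually.1 hM).mono fun t ht => not_lt.1 ht
  have hreg : ∀ t ∈ Ioo 0 T, ∀ x : ℝ³, IsRegularPoint u (t, x) := fun t ht x =>
    isRegularPoint_of_eLpNorm_Icc_lt_top hbdd ht x
  obtain ⟨r, hr, hbddr⟩ :=
    isRegular_finalTime_of_frequently_eLpNorm_three_le hU hlayer hν hT hlh hreg ⟨M, hfreq⟩ x₀
  exact hbddr.ne (eLpNorm_top_parabolicCylinder_eq_top_of_small hT hx₀ hr)

/-- **Seregin 2012, Thm. 1.1 (`seregin_L3_blowup`, ns.S08) from the slab initial layer alone**: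
`seregin_L3_blowup_of_U_of_layer` with **U** discharged (`local_leray_weak_strong_uniqueness_holds`,
`LocalLerayWeakStrongUniquenessHolds.lean`, Lemarié-Rieusset 2016, Thm. 14.7). The remaining
hypothesis is Jia–Šverák's Lemma 8 = Seregin's (2.13) for local energy solutions on short strips
(every-time form). [cite: Seregin2012CMP, Thm. 1.1] [cite: LemarieRieusset2016, Thm. 14.7, Thm. 15.4, Thm. 15.5] -/
theorem seregin_L3_blowup_of_layer
    (hlayer : ∀ M : ℝ≥0, ∃ S₁ : ℝ, 0 < S₁ ∧ ∀ T : ℝ, 0 < T → T ≤ S₁ →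
      ∃ η : ℝ → ℝ≥0, Tendsto η (𝓝[>] 0) (𝓝 0) ∧
      ∀ (a : EuclideanSpace ℝ (Fin 3) → EuclideanSpace ℝ (Fin 3))
        (v : ℝ → EuclideanSpace ℝ (Fin 3) → EuclideanSpace ℝ (Fin 3))
        (π : ℝ → EuclideanSpace ℝ (Fin 3) → ℝ),
        MemLp a 3 volume → eLpNorm a 3 volume ≤ M → IsLocalEnergySolutionOn T 1 a v π →
        ∀ t ∈ Ioo 0 T, ∀ x₀ : EuclideanSpace ℝ (Fin 3),
          eLpNorm (v t - heatTest 1 a t) 2 (volume.restrict (ball x₀ 1)) ≤ η t) :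
    seregin_L3_blowup :=
  seregin_L3_blowup_of_U_of_layer local_leray_weak_strong_uniqueness_holds hlayer

end Literature.Analysis.FluidPDE

end
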